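import Mathlib

/-!
# `BalabanUV.Beta.D1BFx.ColumnSpaceProjector` — road «BF-x» (binder row D1), slot (K), `K-ASSEMBLY-SPEC-v2.md` v2.1 §2 brick **K-TB3b**,
# GENERIC HALF (model level, Mathlib only): the orthogonal projector onto a column space `B (BᵀB)⁻¹ Bᵀ`, its fixed-vector / kernel
# characterisation, **uniqueness of a symmetric idempotent with prescribed fixed vectors**, Gram invertibility ⟺ injectivity, the
# K-TB3b FILE 2 §2–§3 SOCKET «`R = L N (Nᵀ Lᵀ L N)⁻¹ Nᵀ Lᵀ` from `R`'s fixed vectors = `L(ker S)` and `range N = ker S`», and the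
# oblique-projector letters of FILE 1 §2 (`τ τᵀ = 1`, `τ Π = 0`, `Π (1 − τᵀτ) = 1 − τᵀτ` ⟹ `τ W = 1`, `W τ = 1 − Π`, `Π² = Π`, `W := (1 − Π) τᵀ`)

WHY.  The road-«BF-x» owner's brick K-TB3b (journal l.22310, `K-ASSEMBLY-SPEC-v2.md` v2.1 §2) asks, in FILE 2 §3, for THE PROJECTOR FORMULA
`1 − P̂ = L̂ N̂ (N̂ᵀ L̂ L̂ N̂)⁻¹ N̂ᵀ L̂` on every fine torus («both sides symmetric idempotent with range `L̂(block-mean-free)`; two orthogonal projectors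
with the same range coincide») and, in FILE 2 §2, for `IsUnit (N̂ᵀ L̂ L̂ N̂).det` («`L̂` injective on block-mean-free `λ` + `N̂` has independent
columns»); FILE 1 §2 asks for `τ_T Ŵ₀ = 1`, `Ŵ₀ τ_T = 1 − Π̂`, `Ŵ₀ := (1 − Π̂) τ_Tᵀ`.  This module proves the GENERIC finite-linear-algebra content of
those three items once, over Mathlib only; the companion module `D1BFx/ColumnSpaceProjectorRoad` feeds the road owner's `PeriodisedProjector`
letters (`Rhat_transpose` ∕ `Rhat_mul_Rhat` ∕ `Rhat_mulVec_eq_self_iff` ∕ `Ghat_Lhat_mulVec`) into the socket `eq_colProj_comp_of_kernel_range`, so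
that whoever holds K-TB3b supplies only INSTANCE facts about the basis matrix `N̂` to obtain FILE 2's `Rhat_eq` and `isUnit_det_gramLap` BY NAME.
Nothing in this file mentions a torus, a kernel of the cell, or a paper.

CONTENT (all [folklore]; `B : Matrix n ρ K`, indices finite with decidable equality):
* §1 (any field) the column-space projector `B * (Bᵀ * B)⁻¹ * Bᵀ` under `IsUnit (Bᵀ * B).det`: `gram_transpose`, `gram_inv_transpose`,
  `colProj_transpose`, `colProj_mul_self`, `transpose_mul_colProj`, `colProj_mul_colProj`, `colProj_mulVec_apply_range`,
  **`colProj_mulVec_eq_self_iff`** (`P v = v ↔ ∃ c, v = B c`), `colProj_mulVec_eq_zero_iff` (`P v = 0 ↔ Bᵀ v = 0`).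
* §2 (any field) **UNIQUENESS**: `eq_of_symm_idem_of_fixed_iff` — two symmetric idempotent matrices with the same fixed vectors are equal;
  **`eq_colProj_of_fixed_iff`** — a symmetric idempotent whose fixed vectors are exactly `range B` IS `B (BᵀB)⁻¹ Bᵀ`.
* §3 (over `ℝ`) **GRAM INVERTIBILITY**: `isUnit_det_gram_iff_injective : IsUnit (Bᵀ * B).det ↔ Function.Injective B.mulVec`
  (`Matrix.ker_mulVecLin_transpose_mul_self` + `Matrix.mulVec_injective_iff_isUnit`); composite forms `injective_mulVec_mul`,
  `isUnit_det_gram_comp` (`IsUnit (Nᵀ * Lᵀ * L * N).det` from `N` injective and `L` injective on `range N`).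
* §4 (over `ℝ`) **THE K-TB3b SOCKET** `fixed_iff_range_comp`, **`eq_colProj_comp_of_kernel_range`** (general `L`) and
  **`eq_colProj_comp_of_kernel_range_symm`** (`Lᵀ = L`: conclusion `IsUnit (Nᵀ * L * L * N).det ∧ R = L * N * (Nᵀ * L * L * N)⁻¹ * Nᵀ * L` —
  the literal shape of FILE 2's `Rhat_eq` ∕ `isUnit_det_gramLap` ∕ `Amat`).
* §4c (over `ℝ`) basis letters from reconstruction identities: `injective_mulVec_of_left_inv` (`T N = 1`), `kernel_iff_range_of_reconstruction`
  (`S N = 0`, `N T = 1 − M`, `ker S ⊆ ker M` ⟹ `S λ = 0 ↔ λ ∈ range N`).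
* §4b (over `ℝ`) `A := 2 • G⁻¹` bookkeeping: `inv_two_smul_inv`, `two_smul_inv_two_smul_inv` (`2 • (2 • G⁻¹)⁻¹ = G`), `isUnit_det_two_smul_inv`.
* §5 (any field) **OBLIQUE PROJECTOR ALONG A COORDINATE SLICE** (`τ : Matrix ρ ν K`, `Π : Matrix ν ν K`): `tau_mul_one_sub_pi`,
  `tau_mul_W`, `W_mul_tau`, `pi_mul_pi_of_slice`, `one_sub_pi_idem_of_slice`, `det_tau_mul_W`, `mul_W_eq_zero_of_mul_one_sub_pi`, `gram_junction`, and the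
  two slice letters FROM the coordinate-projector rules `Ê Π̂ = Π̂`, `Ê Π̂ Ê = Ê` (`tau_mul_pi_of_E_mul_pi`, `pi_mul_E_of_letters`) —
  FILE 1 §2's `tauT_mul_What0` ∕ `What0 * tauT = 1 − PiHat` ∕ `hτ` and FILE 2 §2's `tauP_mul_What0` reassociation, in letters.

HONEST FRAMING (cell contract, verbatim): «discharging `BetaPertH` makes Bałaban's UV stability UNCONDITIONAL — a real constructive-QFT
result; it is NOT the continuum limit and NOT the Clay problem.»  HONEST DEPENDENCY (verbatim): «continuum YM on T⁴ ⇐ BetaPertH ∧ nine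
spine estimates (0/9 proved); BetaPertH ⇐ (D1) ∧ (D4) ∧ CAP+tail; G-an2-4 gates asym, D1 and NE2/3/4.»  THIS MODULE DISCHARGES NOTHING of
(K), D1 or BetaPertH: [folklore] finite linear algebra over Mathlib only; no `def`, no `def … : Prop`, nothing cited, no wall binder
instantiated, 0 sorry.
NOT summit progress; NEVER «G-an2-4 closed»; NOT (CONV-C), NOT D1, NOT BetaPertH, NOT continuum, NOT Clay.
ABSOLUTE RULE (cell, verbatim): «No internally-minted statement may enter as a cited fact. Every hypothesis is either kernel-proved in this
package or a verbatim quotation of a PUBLISHED theorem with page reference. The manuscript(s) under audit are NOT citable for their own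
disputed steps — they are the thing under adjudication; programme-internal (2001/route/tribunal) claims are never citable.»
Provenance: G-an2-4 formalisation swarm, unit `b2b-balaban-gan24-formalise-leaf-01` (gen 48), cross-lane OFFER «K-TB3b-GEN» to the road-«BF-x»
owner `b2b-balaban-beta-d1-p2` (journal l.22449), 2026-08-20.
-/

namespace Summit.QuantumFields.BalabanUV.Beta.D1BFx.ColumnSpaceProjector

open Matrix

/-! ## §1 The column-space projector `B (BᵀB)⁻¹ Bᵀ` -/

section ColProj

variable {K : Type*} [Field K] {n ρ : Type*} [Fintype n] [Fintype ρ] [DecidableEq ρ]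
variable (B : Matrix n ρ K)

omit [Fintype ρ] [DecidableEq ρ] in
/-- [folklore] The Gram matrix `Bᵀ B` is symmetric. -/
theorem gram_transpose : (Bᵀ * B)ᵀ = Bᵀ * B := by
  rw [transpose_mul, transpose_transpose]

/-- [folklore] The inverse of the Gram matrix is symmetric. -/
theorem gram_inv_transpose : ((Bᵀ * B)⁻¹)ᵀ = (Bᵀ * B)⁻¹ := by
  rw [transpose_nonsing_inv, gram_transpose]

/-- [folklore] **`B (BᵀB)⁻¹ Bᵀ` IS SYMMETRIC.** -/
theorem colProj_transpose : (B * (Bᵀ * B)⁻¹ * Bᵀ)ᵀ = B * (Bᵀ * B)⁻¹ * Bᵀ := by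
  rw [transpose_mul, transpose_mul, transpose_transpose, gram_inv_transpose, ← Matrix.mul_assoc]

variable {B}

/-- [folklore] **`B (BᵀB)⁻¹ Bᵀ · B = B`** (the projector fixes the columns of `B`). -/
theorem colProj_mul_self (hB : IsUnit (Bᵀ * B).det) : B * (Bᵀ * B)⁻¹ * Bᵀ * B = B := by
  rw [Matrix.mul_assoc, Matrix.mul_assoc, nonsing_inv_mul _ hB, Matrix.mul_one]

/-- [folklore] **`Bᵀ · B (BᵀB)⁻¹ Bᵀ = Bᵀ`.** -/
theorem transpose_mul_colProj (hB : IsUnit (Bᵀ * B).det) : Bᵀ * (B * (Bᵀ * B)⁻¹ * Bᵀ) = Bᵀ := by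
  rw [← Matrix.mul_assoc, ← Matrix.mul_assoc, mul_nonsing_inv _ hB, Matrix.one_mul]

/-- [folklore] **`B (BᵀB)⁻¹ Bᵀ` IS IDEMPOTENT.** -/
theorem colProj_mul_colProj (hB : IsUnit (Bᵀ * B).det) :
    B * (Bᵀ * B)⁻¹ * Bᵀ * (B * (Bᵀ * B)⁻¹ * Bᵀ) = B * (Bᵀ * B)⁻¹ * Bᵀ := by
  rw [Matrix.mul_assoc (B * (Bᵀ * B)⁻¹), transpose_mul_colProj hB]

/-- [folklore] The projector fixes every vector of the column space: `P (B c) = B c`. -/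
theorem colProj_mulVec_apply_range (hB : IsUnit (Bᵀ * B).det) (c : ρ → K) :
    (B * (Bᵀ * B)⁻¹ * Bᵀ) *ᵥ (B *ᵥ c) = B *ᵥ c := by
  rw [mulVec_mulVec, colProj_mul_self hB]

/-- [folklore] **FIXED VECTORS = COLUMN SPACE**: `P v = v ↔ ∃ c, v = B c` for `P = B (BᵀB)⁻¹ Bᵀ`. -/
theorem colProj_mulVec_eq_self_iff (hB : IsUnit (Bᵀ * B).det) (v : n → K) :
    (B * (Bᵀ * B)⁻¹ * Bᵀ) *ᵥ v = v ↔ ∃ c : ρ → K, v = B *ᵥ c := by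
  constructor
  · intro h
    refine ⟨((Bᵀ * B)⁻¹ * Bᵀ) *ᵥ v, ?_⟩
    rw [mulVec_mulVec, ← Matrix.mul_assoc, h]
  · rintro ⟨c, rfl⟩
    exact colProj_mulVec_apply_range hB c

/-- [folklore] **KERNEL = ORTHOGONAL COMPLEMENT OF THE COLUMN SPACE**: `P v = 0 ↔ Bᵀ v = 0`. -/
theorem colProj_mulVec_eq_zero_iff (hB : IsUnit (Bᵀ * B).det) (v : n → K) :
    (B * (Bᵀ * B)⁻¹ * Bᵀ) *ᵥ v = 0 ↔ Bᵀ *ᵥ v = 0 := by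
  constructor
  · intro h
    have h' : Bᵀ *ᵥ ((B * (Bᵀ * B)⁻¹ * Bᵀ) *ᵥ v) = 0 := by rw [h, mulVec_zero]
    rwa [mulVec_mulVec, transpose_mul_colProj hB] at h'
  · intro h
    rw [← mulVec_mulVec, h, mulVec_zero]

end ColProj

/-! ## §2 Uniqueness: a symmetric idempotent is determined by its fixed vectors -/

section Unique

variable {K : Type*} [Field K] {n ρ : Type*} [Fintype n] [Fintype ρ] [DecidableEq ρ]

omit [Fintype ρ] [DecidableEq ρ] in
/-- [folklore] If `R` is idempotent and every `R`-fixed vector is `P`-fixed, then `P R = R`. -/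
theorem mul_eq_of_idem_of_fixed {P R : Matrix n n K} (hRR : R * R = R) (h : ∀ v, R *ᵥ v = v → P *ᵥ v = v) : P * R = R := by
  rw [ext_iff_mulVec]
  intro v
  rw [← mulVec_mulVec]
  apply h
  rw [mulVec_mulVec, hRR]

omit [Fintype ρ] [DecidableEq ρ] in
/-- [folklore] **TWO SYMMETRIC IDEMPOTENTS WITH THE SAME FIXED VECTORS COINCIDE** («two orthogonal projectors with the same range are equal»). -/
theorem eq_of_symm_idem_of_fixed_iff {P R : Matrix n n K} (hPt : Pᵀ = P) (hPP : P * P = P) (hRt : Rᵀ = R) (hRR : R * R = R)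
    (h : ∀ v, P *ᵥ v = v ↔ R *ᵥ v = v) : P = R := by
  have hPR : P * R = R := mul_eq_of_idem_of_fixed hRR fun v hv => (h v).2 hv
  have hRP : R * P = P := mul_eq_of_idem_of_fixed hPP fun v hv => (h v).1 hv
  have ht : (R * P)ᵀ = Pᵀ := by rw [hRP]
  rw [transpose_mul, hPt, hRt, hPR] at ht
  exact ht.symm

/-- [folklore] **A SYMMETRIC IDEMPOTENT WHOSE FIXED VECTORS ARE EXACTLY `range B` IS `B (BᵀB)⁻¹ Bᵀ`.** -/
theorem eq_colProj_of_fixed_iff {B : Matrix n ρ K} (hB : IsUnit (Bᵀ * B).det) {R : Matrix n n K} (hRt : Rᵀ = R) (hRR : R * R = R)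
    (hfix : ∀ v, R *ᵥ v = v ↔ ∃ c : ρ → K, v = B *ᵥ c) : R = B * (Bᵀ * B)⁻¹ * Bᵀ :=
  eq_of_symm_idem_of_fixed_iff hRt hRR (colProj_transpose B) (colProj_mul_colProj hB)
    fun v => (hfix v).trans (colProj_mulVec_eq_self_iff hB v).symm

end Unique

/-! ## §3 Gram invertibility ⟺ injectivity (over `ℝ`) -/

section Gram

variable {n ρ k : Type*} [Fintype n] [Fintype ρ] [DecidableEq ρ] [Fintype k]

omit [Fintype k] in
/-- [folklore] **`Bᵀ B` IS INVERTIBLE IFF `B` HAS INDEPENDENT COLUMNS** (real matrices): `IsUnit (Bᵀ * B).det ↔ Function.Injective B.mulVec`. -/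
theorem isUnit_det_gram_iff_injective (B : Matrix n ρ ℝ) : IsUnit (Bᵀ * B).det ↔ Function.Injective B.mulVec := by
  rw [← isUnit_iff_isUnit_det, ← mulVec_injective_iff_isUnit, ← coe_mulVecLin, ← coe_mulVecLin, ← LinearMap.ker_eq_bot,
    ← LinearMap.ker_eq_bot, ker_mulVecLin_transpose_mul_self]

omit [Fintype n] [DecidableEq ρ] in
/-- [folklore] `L N` is injective when `N` is injective and `L` is injective on the range of `N`. -/
theorem injective_mulVec_mul (L : Matrix n k ℝ) (N : Matrix k ρ ℝ) (hN : Function.Injective N.mulVec)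
    (hL : ∀ c : ρ → ℝ, L *ᵥ (N *ᵥ c) = 0 → N *ᵥ c = 0) : Function.Injective (L * N).mulVec := by
  rw [← coe_mulVecLin, ← LinearMap.ker_eq_bot, ker_mulVecLin_eq_bot_iff]
  intro c hc
  rw [← mulVec_mulVec] at hc
  have h0 : N *ᵥ c = N *ᵥ 0 := by rw [hL c hc, mulVec_zero]
  exact hN h0

/-- [folklore] **COMPOSITE GRAM INVERTIBILITY**: `IsUnit (Nᵀ * Lᵀ * L * N).det` from `N` injective and `L` injective on `range N`. -/
theorem isUnit_det_gram_comp (L : Matrix n k ℝ) (N : Matrix k ρ ℝ) (hN : Function.Injective N.mulVec)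
    (hL : ∀ c : ρ → ℝ, L *ᵥ (N *ᵥ c) = 0 → N *ᵥ c = 0) : IsUnit (Nᵀ * Lᵀ * L * N).det := by
  have h := (isUnit_det_gram_iff_injective (L * N)).2 (injective_mulVec_mul L N hN hL)
  rwa [transpose_mul, ← Matrix.mul_assoc] at h

end Gram

/-! ## §4 The K-TB3b socket: `R = L N (Nᵀ Lᵀ L N)⁻¹ Nᵀ Lᵀ` from fixed vectors `L(ker S)` and `range N = ker S` -/

section Socket

variable {n ρ k q : Type*} [Fintype n] [Fintype ρ] [DecidableEq ρ] [Fintype k]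

omit [DecidableEq ρ] in
/-- [folklore] Re-reading the fixed vectors through a basis of `ker S`: if `R v = v ↔ v ∈ L(ker S)` and `ker S = range N`, then
`R v = v ↔ v ∈ range (L N)`. -/
theorem fixed_iff_range_comp {R : Matrix n n ℝ} {L : Matrix n k ℝ} {S : Matrix q k ℝ} {N : Matrix k ρ ℝ}
    (hfix : ∀ v, R *ᵥ v = v ↔ ∃ lam : k → ℝ, S *ᵥ lam = 0 ∧ v = L *ᵥ lam)
    (hN : ∀ lam : k → ℝ, S *ᵥ lam = 0 ↔ ∃ c : ρ → ℝ, lam = N *ᵥ c) (v : n → ℝ) :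
    R *ᵥ v = v ↔ ∃ c : ρ → ℝ, v = (L * N) *ᵥ c := by
  rw [hfix v]
  constructor
  · rintro ⟨lam, hS, rfl⟩
    obtain ⟨c, rfl⟩ := (hN lam).1 hS
    exact ⟨c, by rw [mulVec_mulVec]⟩
  · rintro ⟨c, rfl⟩
    exact ⟨N *ᵥ c, (hN _).2 ⟨c, rfl⟩, by rw [mulVec_mulVec]⟩

/-- [folklore] **THE K-TB3b SOCKET (general `L`).**  Let `R` be symmetric idempotent with fixed vectors exactly `{L λ : S λ = 0}`, let the
columns of `N` be a basis of `ker S` (`S λ = 0 ↔ λ ∈ range N`, `N` injective) and let `L` be injective on `ker S`.  Then the Gram matrix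
`Nᵀ Lᵀ L N` is invertible and **`R = L N (Nᵀ Lᵀ L N)⁻¹ Nᵀ Lᵀ`**. -/
theorem eq_colProj_comp_of_kernel_range {R : Matrix n n ℝ} {L : Matrix n k ℝ} {S : Matrix q k ℝ} {N : Matrix k ρ ℝ}
    (hRt : Rᵀ = R) (hRR : R * R = R)
    (hfix : ∀ v, R *ᵥ v = v ↔ ∃ lam : k → ℝ, S *ᵥ lam = 0 ∧ v = L *ᵥ lam)
    (hN : ∀ lam : k → ℝ, S *ᵥ lam = 0 ↔ ∃ c : ρ → ℝ, lam = N *ᵥ c) (hNinj : Function.Injective N.mulVec)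
    (hL : ∀ lam : k → ℝ, S *ᵥ lam = 0 → L *ᵥ lam = 0 → lam = 0) :
    IsUnit (Nᵀ * Lᵀ * L * N).det ∧ R = L * N * (Nᵀ * Lᵀ * L * N)⁻¹ * Nᵀ * Lᵀ := by
  have hL' : ∀ c : ρ → ℝ, L *ᵥ (N *ᵥ c) = 0 → N *ᵥ c = 0 := fun c hc => hL _ ((hN _).2 ⟨c, rfl⟩) hc
  have hG : IsUnit (Nᵀ * Lᵀ * L * N).det := isUnit_det_gram_comp L N hNinj hL'
  have hG' : IsUnit ((L * N)ᵀ * (L * N)).det := by rwa [transpose_mul, ← Matrix.mul_assoc]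
  refine ⟨hG, ?_⟩
  have h := eq_colProj_of_fixed_iff hG' hRt hRR (fixed_iff_range_comp hfix hN)
  rw [h, transpose_mul, ← Matrix.mul_assoc (Nᵀ * Lᵀ) L N, ← Matrix.mul_assoc _ Nᵀ Lᵀ]

/-- [folklore] **THE K-TB3b SOCKET (symmetric `L`, the literal shape of FILE 2)**: the same with `Lᵀ` replaced by a given `L'` (`Lᵀ = L'`;
on the road `L' = L = L̂`): `IsUnit (Nᵀ * L' * L * N).det ∧ R = L * N * (Nᵀ * L' * L * N)⁻¹ * Nᵀ * L'`. -/
theorem eq_colProj_comp_of_kernel_range_symm {R : Matrix n n ℝ} {L : Matrix n k ℝ} {S : Matrix q k ℝ} {N : Matrix k ρ ℝ}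
    (hRt : Rᵀ = R) (hRR : R * R = R) {L' : Matrix k n ℝ} (hLt : Lᵀ = L')
    (hfix : ∀ v, R *ᵥ v = v ↔ ∃ lam : k → ℝ, S *ᵥ lam = 0 ∧ v = L *ᵥ lam)
    (hN : ∀ lam : k → ℝ, S *ᵥ lam = 0 ↔ ∃ c : ρ → ℝ, lam = N *ᵥ c) (hNinj : Function.Injective N.mulVec)
    (hL : ∀ lam : k → ℝ, S *ᵥ lam = 0 → L *ᵥ lam = 0 → lam = 0) :
    IsUnit (Nᵀ * L' * L * N).det ∧ R = L * N * (Nᵀ * L' * L * N)⁻¹ * Nᵀ * L' := by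
  rw [← hLt]
  exact eq_colProj_comp_of_kernel_range hRt hRR hfix hN hNinj hL

end Socket

/-! ## §4b Weight-inverse bookkeeping: `A := 2 • G⁻¹` (the `Amat` of K-TB3b FILE 2 §1–§2, in letters) -/

section Amat

variable {ρ : Type*} [Fintype ρ] [DecidableEq ρ] {G : Matrix ρ ρ ℝ}

/-- [folklore] `(2⁻¹ • G) * (2 • G⁻¹) = 1` for invertible `G`. -/
theorem half_smul_mul_two_smul_inv (hG : IsUnit G.det) : ((2 : ℝ)⁻¹ • G) * ((2 : ℝ) • G⁻¹) = 1 := by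
  rw [Matrix.smul_mul, Matrix.mul_smul, smul_smul, mul_nonsing_inv _ hG, inv_mul_cancel₀ (two_ne_zero' ℝ), one_smul]

/-- [folklore] **`(2 • G⁻¹)⁻¹ = 2⁻¹ • G`** for invertible `G`. -/
theorem inv_two_smul_inv (hG : IsUnit G.det) : ((2 : ℝ) • G⁻¹)⁻¹ = (2 : ℝ)⁻¹ • G :=
  inv_eq_left_inv (half_smul_mul_two_smul_inv hG)

/-- [folklore] **`2 • (2 • G⁻¹)⁻¹ = G`** (`τ′₀W₀ = 2A₀⁻¹` bookkeeping with `A₀ := 2 • G⁻¹`, `τ′₀W₀ = G`). -/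
theorem two_smul_inv_two_smul_inv (hG : IsUnit G.det) : (2 : ℝ) • ((2 : ℝ) • G⁻¹)⁻¹ = G := by
  rw [inv_two_smul_inv hG, smul_smul, mul_inv_cancel₀ (two_ne_zero' ℝ), one_smul]

/-- [folklore] **`A₀ := 2 • G⁻¹` IS INVERTIBLE** (the `hA` ∕ `det A₀ ≠ 0` of K-TA4G). -/
theorem isUnit_det_two_smul_inv (hG : IsUnit G.det) : IsUnit ((2 : ℝ) • G⁻¹).det :=
  isUnit_det_of_left_inverse (half_smul_mul_two_smul_inv hG)

end Amat

/-! ## §4c Basis letters from reconstruction identities: `S N = 0`, `T N = 1`, `N T = 1 − M` with `ker S ⊆ ker M` -/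

section Basis

variable {k ρ q : Type*} [Fintype k] [Fintype ρ] [DecidableEq ρ] [DecidableEq k]

omit [DecidableEq k] in
/-- [folklore] **INDEPENDENT COLUMNS FROM A LEFT INVERSE**: `T N = 1 ⟹ N` injective (on the road `T := τ_T ĝrad`, `τ_T Ŵ₀ = 1`, `Ŵ₀ = ĝrad N̂`). -/
theorem injective_mulVec_of_left_inv {N : Matrix k ρ ℝ} {T : Matrix ρ k ℝ} (hTN : T * N = 1) : Function.Injective N.mulVec :=
  Function.LeftInverse.injective (g := T.mulVec) fun c => by rw [mulVec_mulVec, hTN, one_mulVec]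

omit [DecidableEq ρ] in
/-- [folklore] **`ker S = range N` FROM A RECONSTRUCTION IDENTITY**: `S N = 0` (the columns of `N` lie in `ker S`), `N T = 1 − M` (reconstruction
modulo `M`) and `ker S ⊆ ker M` give `S λ = 0 ↔ λ ∈ range N` (on the road: `Ŝ N̂ = 0`, `N̂ (τ_T ĝrad) = 1 − (m+1)⁻⁴ • Ŝ` = «a block-mean-free
function is the comb integral of its gradient», `M := (m+1)⁻⁴ • Ŝ`). -/
theorem kernel_iff_range_of_reconstruction {N : Matrix k ρ ℝ} {T : Matrix ρ k ℝ} {S : Matrix q k ℝ} {M : Matrix k k ℝ}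
    (hSN : S * N = 0) (hNT : N * T = 1 - M) (hM : ∀ lam : k → ℝ, S *ᵥ lam = 0 → M *ᵥ lam = 0) (lam : k → ℝ) :
    S *ᵥ lam = 0 ↔ ∃ c : ρ → ℝ, lam = N *ᵥ c := by
  constructor
  · intro h
    refine ⟨T *ᵥ lam, ?_⟩
    rw [mulVec_mulVec, hNT, sub_mulVec, one_mulVec, hM lam h, sub_zero]
  · rintro ⟨c, rfl⟩
    rw [mulVec_mulVec, hSN, zero_mulVec]

end Basis

/-! ## §5 The oblique projector along a coordinate slice (FILE 1 §2 in letters) -/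

section Oblique

variable {K : Type*} [Field K] {ν ρ μ : Type*} [Fintype ν] [DecidableEq ν] [Fintype ρ] [DecidableEq ρ]

omit [Fintype ρ] [DecidableEq ρ] in
/-- [folklore] `τ Π = 0 ⟹ τ (1 − Π) = τ`. -/
theorem tau_mul_one_sub_pi {τ : Matrix ρ ν K} {Pm : Matrix ν ν K} (hτP : τ * Pm = 0) : τ * (1 - Pm) = τ := by
  rw [Matrix.mul_sub, Matrix.mul_one, hτP, sub_zero]

omit [Fintype ρ] in
/-- [folklore] **`τ W = 1`** for `W := (1 − Π) τᵀ`, from `τ τᵀ = 1` (coordinate rows) and `τ Π = 0` (the range of `Π` lies in the slice `ker τ`). -/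
theorem tau_mul_W {τ : Matrix ρ ν K} {Pm : Matrix ν ν K} (hτ : τ * τᵀ = 1) (hτP : τ * Pm = 0) : τ * ((1 - Pm) * τᵀ) = 1 := by
  rw [← Matrix.mul_assoc, tau_mul_one_sub_pi hτP, hτ]

/-- [folklore] Hence `det (τ W) = 1` (the `hτ` of K-TA4G). -/
theorem det_tau_mul_W {τ : Matrix ρ ν K} {Pm : Matrix ν ν K} (hτ : τ * τᵀ = 1) (hτP : τ * Pm = 0) : (τ * ((1 - Pm) * τᵀ)).det = 1 := by
  rw [tau_mul_W hτ hτP, det_one]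

omit [DecidableEq ρ] in
/-- [folklore] **`W τ = 1 − Π`** for `W := (1 − Π) τᵀ`, from `Π (1 − τᵀτ) = 1 − τᵀτ` (`Π` is the identity on the slice). -/
theorem W_mul_tau {τ : Matrix ρ ν K} {Pm : Matrix ν ν K} (hPE : Pm * (1 - τᵀ * τ) = 1 - τᵀ * τ) : (1 - Pm) * τᵀ * τ = 1 - Pm := by
  have h2 : Pm * (τᵀ * τ) = Pm - (1 - τᵀ * τ) := by
    rw [← hPE, Matrix.mul_sub, Matrix.mul_one, sub_sub_cancel]
  rw [Matrix.mul_assoc, Matrix.sub_mul, Matrix.one_mul, h2]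
  abel

omit [DecidableEq ρ] in
/-- [folklore] **`Π² = Π`** from the two slice letters `τ Π = 0` and `Π (1 − τᵀτ) = 1 − τᵀτ`. -/
theorem pi_mul_pi_of_slice {τ : Matrix ρ ν K} {Pm : Matrix ν ν K} (hτP : τ * Pm = 0) (hPE : Pm * (1 - τᵀ * τ) = 1 - τᵀ * τ) :
    Pm * Pm = Pm := by
  have h1 : Pm = Pm * (τᵀ * τ) + (1 - τᵀ * τ) := by
    rw [← hPE, Matrix.mul_sub, Matrix.mul_one, add_sub_cancel]
  nth_rw 1 [h1]
  rw [Matrix.add_mul, Matrix.sub_mul, Matrix.one_mul, Matrix.mul_assoc, Matrix.mul_assoc, hτP, Matrix.mul_zero, Matrix.mul_zero,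
    zero_add, sub_zero]

omit [DecidableEq ρ] in
/-- [folklore] … equivalently `(1 − Π)² = 1 − Π`. -/
theorem one_sub_pi_idem_of_slice {τ : Matrix ρ ν K} {Pm : Matrix ν ν K} (hτP : τ * Pm = 0) (hPE : Pm * (1 - τᵀ * τ) = 1 - τᵀ * τ) :
    (1 - Pm) * (1 - Pm) = 1 - Pm := by
  rw [Matrix.sub_mul, Matrix.one_mul, Matrix.mul_sub, Matrix.mul_one, pi_mul_pi_of_slice hτP hPE, sub_self, sub_zero]

omit [Fintype ρ] [DecidableEq ρ] in
/-- [folklore] **WARD LETTERS TRANSPORT**: `X (1 − Π) = 0 ⟹ X W = 0` for `W := (1 − Π) τᵀ` (used with `X = K̂` and `X = Q̂`). -/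
theorem mul_W_eq_zero_of_mul_one_sub_pi {X : Matrix μ ν K} {τ : Matrix ρ ν K} {Pm : Matrix ν ν K} (hX : X * (1 - Pm) = 0) :
    X * ((1 - Pm) * τᵀ) = 0 := by
  rw [← Matrix.mul_assoc, hX, Matrix.zero_mul]

/-- [folklore] **THE FIRST SLICE LETTER FROM THE COORDINATE-PROJECTOR RULE**: `τ τᵀ = 1` and `(1 − τᵀτ) Π = Π` (the range of `Π` lies in
the slice; on the road: `Ê ∘ Π̂ = Π̂`, `Ê = fromBlocks (1 − τ_Tᵀτ_T) 0 0 1`) give `τ Π = 0`. -/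
theorem tau_mul_pi_of_E_mul_pi {τ : Matrix ρ ν K} {Pm : Matrix ν ν K} (hτ : τ * τᵀ = 1) (hEP : (1 - τᵀ * τ) * Pm = Pm) :
    τ * Pm = 0 := by
  rw [← hEP, ← Matrix.mul_assoc, Matrix.mul_sub, Matrix.mul_one, ← Matrix.mul_assoc, hτ, Matrix.one_mul, sub_self,
    Matrix.zero_mul]

omit [DecidableEq ρ] in
/-- [folklore] **THE SECOND SLICE LETTER FROM THE COORDINATE-PROJECTOR RULES**: `(1 − τᵀτ) Π = Π` and `(1 − τᵀτ) Π (1 − τᵀτ) = 1 − τᵀτ`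
(on the road: `Ê Π̂ = Π̂` and `Ê Π̂ Ê = Ê`, the periodised `comp_axEc_piKBmC`) give `Π (1 − τᵀτ) = 1 − τᵀτ`. -/
theorem pi_mul_E_of_letters {τ : Matrix ρ ν K} {Pm : Matrix ν ν K} (hEP : (1 - τᵀ * τ) * Pm = Pm)
    (hEPE : (1 - τᵀ * τ) * Pm * (1 - τᵀ * τ) = 1 - τᵀ * τ) : Pm * (1 - τᵀ * τ) = 1 - τᵀ * τ :=
  calc Pm * (1 - τᵀ * τ) = (1 - τᵀ * τ) * Pm * (1 - τᵀ * τ) := by rw [hEP]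
    _ = 1 - τᵀ * τ := hEPE

omit [DecidableEq ν] [Fintype ρ] [DecidableEq ρ] in
/-- [folklore] **THE GRAM JUNCTION** (FILE 2 §2 reassociation): for `τ' := Nᵀ L Gᵀ` and `W := G N` with `Gᵀ G = L`, `τ' W = Nᵀ L L N`. -/
theorem gram_junction {k : Type*} [Fintype k] {N : Matrix k ρ K} {L : Matrix k k K} {G : Matrix ν k K} (hG : Gᵀ * G = L) :
    Nᵀ * L * Gᵀ * (G * N) = Nᵀ * L * L * N := by
  rw [← Matrix.mul_assoc, Matrix.mul_assoc (Nᵀ * L), hG]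

end Oblique

end Summit.QuantumFields.BalabanUV.Beta.D1BFx.ColumnSpaceProjector
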